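import Literature.Barriers.ABC.BakerMethodBoundsStewartYu1991LineProofs
import Literature.NumberTheory.Transcendental.Waldschmidt1980HW2
import HarnessLib

/-!
# Stewart–Yu 1991 from Yu 1990 alone: the archimedean input is Waldschmidt 1980

Complement to `BakerMethodBoundsStewartYu1991LineProofs.lean`: of the two 1990 inputs of

> C. L. Stewart, Kunrui Yu, *On the abc conjecture*, Math. Ann. **291** (1991), 225–230,
> Theorem 1: `log c ≤ rad(abc)^{2/3 + ε}` for `c ≥ c₀(ε)`

(`Literature.Barriers.ABC.stewartYu1991_upperBound`), namely (Y) Yu 1990 at the finite places and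
(W) Waldschmidt 1980 at the infinite place, the binder (W) of
`stewartYu1991_of_yu1990_waldschmidt1980` is now PROVED:
`Literature.NumberTheory.Transcendental.Waldschmidt1980.waldschmidt1980_hW₂` (M. Waldschmidt, *A
lower bound for linear forms in logarithms*, Acta Arith. **37** (1980), Proposition 3.8 over `ℚ`
with `q = 2`, in the shape `hW₂`, constant `C(m) = (2⁷⁰ m)ᵐ`, formalized sorry-free in
`Literature/NumberTheory/Transcendental/Waldschmidt1980*.lean` on the skeleton of the tree's
Cijsouw–Waldschmidt files). Hence Stewart–Yu 1991 follows from Yu's `p`-adic estimate (the shape of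
Kunrui Yu, *Linear forms in p-adic logarithms II*, Compositio Math. **74** (1990), Corollary 2.3
over the Kummer fields `ℚ(ζ₄)`, `ℚ(ζ₃)`) ALONE.

## References
* C. L. Stewart, Kunrui Yu, *On the abc conjecture*, Math. Ann. 291 (1991), 225–230, Theorem 1.
* M. Waldschmidt, *A lower bound for linear forms in logarithms*, Acta Arith. 37 (1980), 257–283,
  Proposition 3.8.
* Kunrui Yu, *Linear forms in p-adic logarithms II*, Compositio Math. 74 (1990), 15–113,
  Theorem 2.1, Corollary 2.3.
-/

noncomputable section

open Finset Real Height
open Literature.NumberTheory.Transcendental.Waldschmidt1980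

namespace Literature.Barriers.ABC

/-- **Stewart–Yu 1991 from Yu 1990 alone.** If the `p`-adic valuations of `α₁^{b₁}⋯αₙ^{bₙ} − 1`
for rational primes `αⱼ` are bounded in the shape of Yu 1990, Corollary 2.3 (dependence
`(c₅ n)ⁿ · p² · log B · log log A · ∏ log Aⱼ`), then `log c ≤ rad(abc)^{2/3+ε}` for `c ≥ c₀(ε)`:
the archimedean input (Waldschmidt 1980, Proposition 3.8 over `ℚ`, dependence `(c₆ n)ⁿ` and
`log B · log log A`) is the theorem `waldschmidt1980_hW₂`.
[cite: StewartYu1991, Theorem 1 and §3 (pp. 226–230)] [cite: Waldschmidt1980, Prop. 3.8 (p. 263)] [cite: Yu1990, Cor. 2.3] -/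
theorem stewartYu1991_of_yu1990 (c₅ : ℝ)
    (hY : ∀ (p : ℕ), p.Prime → ∀ (S : Finset ℕ), (∀ q ∈ S, q.Prime) → p ∉ S → S.Nonempty →
      ∀ (e : ℕ → ℤ) (B : ℝ), 3 ≤ B → (∀ q ∈ S, (|e q| : ℝ) ≤ B) →
      ∏ q ∈ S, (q : ℚ) ^ e q ≠ 1 →
      (padicValRat p (∏ q ∈ S, (q : ℚ) ^ e q - 1) : ℝ) <
        (c₅ * S.card) ^ S.card * (p : ℝ) ^ 2 * Real.log B *
          Real.log (Real.log ((max 4 (S.sup id) : ℕ) : ℝ)) *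
          ∏ q ∈ S, Real.log ((max 4 q : ℕ) : ℝ)) :
    stewartYu1991_upperBound :=
  stewartYu1991_of_yu1990_waldschmidt1980 w80Cw c₅ (2 ^ 70) w80Cw_nonneg (fun n => w80Cw_le n) hY
    (fun n α b V W h1 h2 h3 h4 h5 h6 h7 h8 => waldschmidt1980_hW₂ n α b V W h1 h2 h3 h4 h5 h6 h7 h8)

end Literature.Barriers.ABC

end
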